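import Literature.MathematicalPhysics.QuantumFieldTheory.Balaban1983to89.B9SupplySockB9P3ZdGammaInAkDpZd
import Literature.MathematicalPhysics.QuantumFieldTheory.Balaban1983to89.B9Eq321LandauProjectionZd

/-!
# `Balaban1983to89.B9SupplySockB9P3ZdGenuineDpDRDs` — THE J-N06→N05 JUNCTION'S LETTER RECORD WITH TWO GENUINE LETTERS AT ONCE:
# `Δ′(U₀)` of [Balaban1985BackgroundPropagators] (3.10) (dag-n06-w2's `withDpZd`, p586146) AND `D R(U₀) D*` of (3.20)–(3.26) (dag-n06-w4's `opsLandau τ`,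
# p585863) — the two record edits COMMUTE, and the composite record carries BOTH object-borne binders: `CurvAtInAk` ((3.69) in B8's (1.7)-currency) and
# `LandauAt` (the Landau condition kills the `DRD*` term) — referee dag-ref-L READ-33's note «two record edits on different fields, composition unstated» answered

statement-level skeleton of published theorems with citation tags; proofs where landed; nothing here is a claim about the
Yang–Mills mass gap

PDF held: `paper:balaban1985-cmp99-background-propagators` ([4] = B9; journal page = PDF page + 388), p. 392 (3.10), pp. 394–395 (3.20)–(3.27), p. 404 (3.69);
`paper:balaban1985-cmp99-regular-spaces-gauge-fixing` (B8), p. 77 (1.7), p. 83 (1.42), p. 86 (1.58) — quoted in the two imported files, BY NAME.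

WHY THIS FILE (cell `pub-ymgap`, HUMAN RULING D-0062 ∕ D-0149; seat `pub-ymgap-dag-n06-w2` (g0), node N06 = [B9]; count-neutral).  The junction's letter
record `OpsZd` has four letters; two are now OBJECTS, each plugged by a record edit of its own field: `withDpZd` (field `Dp`, this seat) and `opsLandau τ`
(field `DRDs`, dag-n06-w4, against a tracial∕Hermitian∕faithful `τ`).  Referee dag-ref-L (READ-33, INBOX 00:13Z) noted that the composite was stated
nowhere.  Here: the edits commute definitionally, and at the composite `opsLandau τ (withDpZd ops₀)` BOTH binders the suppliers
(`B9SupplySockB9P3ZdGammaInAk.sockB9P3D4γI_at`, `…GammaUnivInAk.sockB9P3PI_at_univ`) ask of those two fields are THEOREMS — `CurvAtInAk` for every member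
with `1 ≤ M` (p586146), `LandauAt` for every member with finite `Ω₀` under n06-w4's `τ`-hypotheses (p585863) — leaving `Gop` (G(U₀), the Thm 3.11 regime)
and `QQ` (Q*aQ, against the same `τ`) as the letters still carried by hypotheses (`InvAt`, `AvgAt*`, `HolderAt*`, `GopAddAt`, `DictAt`).

WHAT IS PROVED (0 sorry; proof lane — no `def`).
* `opsLandau_withDpZd_comm` — `opsLandau τ (withDpZd ops₀) = withDpZd (opsLandau τ ops₀)` (rfl); `opsLandau_withDpZd_Dp` ∕ `_Gop` ∕ `_QQ` (rfl readings).
* ★★ `curvAtInAk_opsLandau_withDpZd` — `CurvAtInAk L (opsLandau τ (withDpZd ops₀)) (14·(d−1)) M i m` (`1 ≤ L`, `1 ≤ M`; any `τ`).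
* ★★ `landauAt_opsLandau_withDpZd` — `LandauAt bg L mem ιCfg (opsLandau τ (withDpZd ops₀)) c35 a₃ M i m` at members with `(i.Ω 0).Finite`, under
  n06-w4's three `τ`-hypotheses and `[FiniteDimensional ℝ 𝔸]` (his theorem, verbatim at `ops₀ := withDpZd ops₀`); `…_complex` (the `𝔸 = ℂ`, `τ = id` instance, no
  hypothesis left).
* ★ `both_binders_opsLandau_withDpZd` — the conjunction, for the record.

HONEST SCOPE.  Bookkeeping over p586146 and p585863 (nothing of either re-proved; both cited BY NAME); 0 estimates; `Gop`, `QQ` stay letters; count-neutral;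
N05 ∕ N06 NOT discharged; one finite lattice programme at fixed `ε`; R4 closes the conditional finite-𝕋⁴ rung `BalabanLadder.UV` only; nothing continuum ∕
ℝ⁴ ∕ OS ∕ mass-gap ∕ Clay.  Unit `pub-ymgap-dag-n06-w2` (g0), 2026-08-28.
-/

noncomputable section

namespace Literature.MathematicalPhysics.QuantumFieldTheory.Balaban1983to89.B9SupplySockB9P3ZdGenuineDpDRDs

open B7Prop2Explicit (unitaryUnits)
open B8LeafModelZd (ZdIdx)
open B9SupplySockB9P3ZdLetters (OpsZd)
open B9SupplySockB9P3ZdAt (LandauAt)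
open B9SupplySockB9P3ZdGammaInAk (CurvAtInAk)
open B9SupplySockB9P3ZdGammaInAkDpZd (withDpZd curvAtInAk_of_Dp_eq)
open B9Eq321LandauProjectionZd (opsLandau landauAt_opsLandau landauAt_opsLandau_complex)
open B9Eq369CurvSmallZd (DpZd)

-- `Site` alone could resolve to the torus sites of `Setup.lean`; re-export the `ℤ^d` sites of `B7Prop1Explicit`.
export B7Prop1Explicit (Site)

variable {d : ℕ} {𝔸 : Type*} [CStarAlgebra 𝔸] (τ : 𝔸 →ₗ[ℂ] ℂ) {L : ℕ}

/-! ## §1 The two record edits commute -/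

/-- **THE EDITS COMMUTE**: plugging the genuine `Δ′` and the genuine `DRD*` in either order gives the same record (different fields).
[cite: Balaban1985BackgroundPropagators, (3.26) p.395 («Δ_a = Δ + DRD* + Q*aQ» with (3.10) «Δ = D*D + Δ′»)] -/
theorem opsLandau_withDpZd_comm (ops₀ : ℝ → ZdIdx d L → ℕ → OpsZd d 𝔸) :
    opsLandau τ (withDpZd ops₀) = withDpZd (opsLandau τ ops₀) := rfl

/-- the `Dp` field of the composite is the genuine `Δ′`. [cite: Balaban1985BackgroundPropagators, (3.10) p.392] -/
theorem opsLandau_withDpZd_Dp (ops₀ : ℝ → ZdIdx d L → ℕ → OpsZd d 𝔸) (M : ℝ) (i : ZdIdx d L) (m : ℕ) :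
    (opsLandau τ (withDpZd ops₀) M i m).Dp = DpZd i.η := rfl

/-- the `Gop` field of the composite is `ops₀`'s letter. [cite: Balaban1985BackgroundPropagators, (3.27) p.395] -/
theorem opsLandau_withDpZd_Gop (ops₀ : ℝ → ZdIdx d L → ℕ → OpsZd d 𝔸) (M : ℝ) (i : ZdIdx d L) (m : ℕ) :
    (opsLandau τ (withDpZd ops₀) M i m).Gop = (ops₀ M i m).Gop := rfl

/-- the `QQ` field of the composite is `ops₀`'s letter. [cite: Balaban1985BackgroundPropagators, (3.16) p.393] -/
theorem opsLandau_withDpZd_QQ (ops₀ : ℝ → ZdIdx d L → ℕ → OpsZd d 𝔸) (M : ℝ) (i : ZdIdx d L) (m : ℕ) :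
    (opsLandau τ (withDpZd ops₀) M i m).QQ = (ops₀ M i m).QQ := rfl

/-! ## §2 Both object-borne binders hold at the composite record -/

/-- ★★ **`CurvAtInAk` AT THE COMPOSITE RECORD** (any `τ`; `1 ≤ L`, `1 ≤ M`): the (3.69)-binder of edition γ·InAk for the record carrying the genuine `Δ′`
and the genuine `DRD*`, by p586146's `curvAtInAk_of_Dp_eq` (the `Dp` field is `DpZd` by `rfl`).
[cite: Balaban1985BackgroundPropagators, (3.69) p.404; Balaban1985RegularSpaces, (1.7) p.77] -/
theorem curvAtInAk_opsLandau_withDpZd [Nontrivial 𝔸] (hL : 1 ≤ L) (ops₀ : ℝ → ZdIdx d L → ℕ → OpsZd d 𝔸) {M : ℝ} (hM : 1 ≤ M)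
    (i : ZdIdx d L) (m : ℕ) : CurvAtInAk L (opsLandau τ (withDpZd ops₀)) (14 * ((d - 1 : ℕ) : ℝ)) M i m :=
  curvAtInAk_of_Dp_eq hL (fun M i m => opsLandau_withDpZd_Dp τ ops₀ M i m) hM i m

/-- ★★ **`LandauAt` AT THE COMPOSITE RECORD** (members with finite `Ω₀`; n06-w4's three `τ`-hypotheses — tracial, Hermitian, faithful — and a
finite-dimensional `𝔸`): dag-n06-w4's `landauAt_opsLandau` at `ops₀ := withDpZd ops₀`, verbatim.
[cite: Balaban1985BackgroundPropagators, (3.20)–(3.22) p.394, (3.26) p.395; Balaban1985RegularSpaces, (1.42) p.83, (1.58) p.86] -/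
theorem landauAt_opsLandau_withDpZd [NeZero L] [FiniteDimensional ℝ 𝔸] (hτt : ∀ a b : 𝔸, τ (a * b) = τ (b * a))
    (hτs : ∀ a : 𝔸, τ (star a) = starRingEnd ℂ (τ a)) (hτp : ∀ a : 𝔸, a ≠ 0 → 0 < (τ (star a * a)).re)
    (ops₀ : ℝ → ZdIdx d L → ℕ → OpsZd d 𝔸)
    {I : Type} (bg : I → B9.Backgrounds) (mem : ℝ → ZdIdx d L → ℕ → I)
    (ιCfg : ∀ (M : ℝ) (i : ZdIdx d L) (m : ℕ) (U₀ : Site d → Fin d → 𝔸ˣ), (∀ x κ, U₀ x κ ∈ unitaryUnits 𝔸) → (bg (mem M i m)).Cfg)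
    (c35 a₃ M : ℝ) (i : ZdIdx d L) (m : ℕ) (hΩ : (i.Ω 0).Finite) :
    LandauAt bg L mem ιCfg (opsLandau τ (withDpZd ops₀)) c35 a₃ M i m :=
  landauAt_opsLandau τ hτt hτs hτp (withDpZd ops₀) bg mem ιCfg c35 a₃ M i m hΩ

/-- the abelian fibre `𝔸 = ℂ`, `τ = id`: `LandauAt` at the composite record with NO hypothesis left (n06-w4's `landauAt_opsLandau_complex` at `withDpZd ops₀`).
[cite: Balaban1985BackgroundPropagators, (3.20)–(3.22) p.394; Balaban1985RegularSpaces, (1.42) p.83] -/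
theorem landauAt_opsLandau_withDpZd_complex [NeZero L] (ops₀ : ℝ → ZdIdx d L → ℕ → OpsZd d ℂ)
    {I : Type} (bg : I → B9.Backgrounds) (mem : ℝ → ZdIdx d L → ℕ → I)
    (ιCfg : ∀ (M : ℝ) (i : ZdIdx d L) (m : ℕ) (U₀ : Site d → Fin d → ℂˣ), (∀ x κ, U₀ x κ ∈ unitaryUnits ℂ) → (bg (mem M i m)).Cfg)
    (c35 a₃ M : ℝ) (i : ZdIdx d L) (m : ℕ) (hΩ : (i.Ω 0).Finite) :
    LandauAt bg L mem ιCfg (opsLandau (LinearMap.id : ℂ →ₗ[ℂ] ℂ) (withDpZd ops₀)) c35 a₃ M i m :=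
  landauAt_opsLandau_complex (withDpZd ops₀) bg mem ιCfg c35 a₃ M i m hΩ

/-- ★ **BOTH OBJECT-BORNE BINDERS AT ONCE** at the composite record `opsLandau τ (withDpZd ops₀)` (finite `Ω₀`, `1 ≤ L`, `1 ≤ M`, finite-dimensional `𝔸`,
n06-w4's `τ`-hypotheses): `CurvAtInAk` ∧ `LandauAt`. [cite: Balaban1985BackgroundPropagators, (3.69) p.404, (3.20)–(3.26) pp.394–395; Balaban1985RegularSpaces, (1.7) p.77, (1.42) p.83] -/
theorem both_binders_opsLandau_withDpZd [Nontrivial 𝔸] [NeZero L] [FiniteDimensional ℝ 𝔸] (hL : 1 ≤ L)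
    (hτt : ∀ a b : 𝔸, τ (a * b) = τ (b * a)) (hτs : ∀ a : 𝔸, τ (star a) = starRingEnd ℂ (τ a))
    (hτp : ∀ a : 𝔸, a ≠ 0 → 0 < (τ (star a * a)).re) (ops₀ : ℝ → ZdIdx d L → ℕ → OpsZd d 𝔸)
    {I : Type} (bg : I → B9.Backgrounds) (mem : ℝ → ZdIdx d L → ℕ → I)
    (ιCfg : ∀ (M : ℝ) (i : ZdIdx d L) (m : ℕ) (U₀ : Site d → Fin d → 𝔸ˣ), (∀ x κ, U₀ x κ ∈ unitaryUnits 𝔸) → (bg (mem M i m)).Cfg)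
    (c35 a₃ : ℝ) {M : ℝ} (hM : 1 ≤ M) (i : ZdIdx d L) (m : ℕ) (hΩ : (i.Ω 0).Finite) :
    CurvAtInAk L (opsLandau τ (withDpZd ops₀)) (14 * ((d - 1 : ℕ) : ℝ)) M i m ∧
      LandauAt bg L mem ιCfg (opsLandau τ (withDpZd ops₀)) c35 a₃ M i m :=
  ⟨curvAtInAk_opsLandau_withDpZd τ hL ops₀ hM i m, landauAt_opsLandau_withDpZd τ hτt hτs hτp ops₀ bg mem ιCfg c35 a₃ M i m hΩ⟩

end Literature.MathematicalPhysics.QuantumFieldTheory.Balaban1983to89.B9SupplySockB9P3ZdGenuineDpDRDs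

end
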